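import HarnessLib
import Summits.Langlands.Langlands.Theses.SkinnerWilesDefectOne
import Summits.Langlands.Langlands.Theorems.BianchiCongruenceCohomologyFinite.Negative.FalseWithoutFinite

/-!
# `BianchiCongruenceCohomologyFinite` (stmt-Langlands-15362) — Negative knowledge: the compactness
# of the level `U` is load-bearing

Crux-disprover lemma (cdisprove, 2026-08-16) for the crux
`∀ K imaginary quadratic, ∀ U ≤ GL₂(𝔸_K^∞) compact open, ∀ A : Rep ℤ (GL₂(K) ∩ U) finite, ∀ q,
Finite (groupCohomology A q)` (Borel–Serre finiteness for Bianchi congruence subgroups — a theorem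
in print; no `¬`-theorem of the crux itself is expected).  The batch refuter's stamp recorded
"drop `IsCompact` ⇒ false ON PAPER (`Γ = GL₂(K)`, `H¹(·, ℤ/2) = Hom(K^×, ℤ/2)` infinite)"; this file
makes it a kernel-checked theorem:

* the characters `Kˣ → ℤ`, `x ↦ v_p(N_{K/ℚ} x)`, `p` a rational prime — infinitely many
  independent characters of `K^×` (no prime ideals of `𝓞 K`, no Čebotarev, no class field
  theory: the norm to `ℚ` and `padicValRat` suffice; built inline with `MonoidHom.mk'`);
* `not_finite_H1_trivial_zmod_three` — for `[K : ℚ] = 2` and the (open, NON-compact) level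
  `U = ⊤ = GL₂(𝔸_K^∞)`, so that `Γ_U = GL₂(K)`, the group `H¹(GL₂(K), ℤ/3) = Hom(GL₂(K), ℤ/3)`
  (`groupCohomology.H1IsoOfIsTrivial`) is INFINITE: the characters
  `γ ↦ v_p(N_{K/ℚ}(det γ)) mod 3`, `p` prime, are pairwise distinct (test on `diag(ℓ, 1)`:
  `v_p(N(ℓ)) = v_p(ℓ²) = 2·[p = ℓ] ≢ 0 mod 3`), and there are infinitely many primes;
  coefficients `ℤ/3` rather than `ℤ/2` only because `N_{K/ℚ}(ℓ) = ℓ^{[K:ℚ]} = ℓ²`;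
* `bianchiCongruenceCohomologyFinite_false_without_isCompact` — drop `IsCompact U` from the crux and
  it is FALSE (witness `K = ℚ(ζ₃)`, `U = ⊤`, `A = ℤ/3` trivial, `q = 1`): any proof must use the
  compactness of the level, i.e. that `Γ_U` is an ARITHMETIC group (commensurable with
  `GL₂(𝓞_K)`, in-tree `BigHeckeGLn.commensurable_comap_globalEmbedding_glIntegers`) and not merely
  a subgroup of `GL₂(K)` cut out by an open condition — `GL₂(K)` itself is not finitely generated
  (its abelianisation `K^×` has infinite `𝔽₃`-rank), so already `H¹` with finite coefficients is
  infinite.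

No statement of the route is used or asserted. [folklore]
-/

set_option linter.dupNamespace false -- project-wide option (lakefile weak.linter.dupNamespace); `Summit.Langlands.Langlands` is the mandated namespace

noncomputable section

open CategoryTheory NumberField
open Literature.NumberTheory.Automorphic

namespace Summit.Langlands.Langlands.Theorems.BianchiCongruenceCohomologyFinite.Negative

/-- `det diag(u, 1) = u` in `GL₂`. [folklore] -/
theorem det_glDiagonal_two_one {R : Type} [CommRing R] (u : Rˣ) :
    Matrix.GeneralLinearGroup.det (glDiagonal 2 R ![u, 1]) = u := by
  refine Units.ext ?_
  rw [Matrix.GeneralLinearGroup.val_det_apply, coe_glDiagonal, Matrix.det_diagonal,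
    Fin.prod_univ_two]
  simp

/-! ### `H¹(GL₂(K), ℤ/3)` is infinite for a quadratic field `K` -/

/-- **`H¹(GL₂(K), ℤ/3)` is infinite** for a quadratic number field `K`, where `GL₂(K)` is written
as the congruence subgroup `Γ_⊤ = GL₂(K) ∩ GL₂(𝔸_K^∞)` of the (open, non-compact) full level
`U = ⊤`: `H¹ = Hom(Γ_⊤, ℤ/3)` (`groupCohomology.H1IsoOfIsTrivial`) contains the pairwise distinct
characters `γ ↦ v_p(N_{K/ℚ}(det γ)) mod 3`, `p` prime — distinct because on `diag(ℓ, 1)` the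
`p`-th character takes the value `v_p(ℓ²) = 2·[p = ℓ] mod 3` — and `Nat.Primes` is infinite.
[folklore] -/
theorem not_finite_H1_trivial_zmod_three (K : Type) [Field K] [NumberField K]
    (h2 : Module.finrank ℚ K = 2) :
    ¬ Finite (groupCohomology (Rep.trivial ℤ
      ((⊤ : Subgroup (BigHeckeGLn.FiniteAdelicGL 2 K)).comap (BigHeckeGLn.globalEmbedding 2 K))
      (ZMod 3)) 1) := by
  set Γ := (⊤ : Subgroup (BigHeckeGLn.FiniteAdelicGL 2 K)).comap (BigHeckeGLn.globalEmbedding 2 K)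
    with hΓ
  intro hfin
  -- `H¹(Γ, ℤ/3) ≅ Hom(Γ, ℤ/3)`
  have e := (groupCohomology.H1IsoOfIsTrivial (Rep.trivial ℤ Γ (ZMod 3))).toLinearEquiv.toEquiv
  haveI : Finite (Additive Γ →+ ZMod 3) := Finite.of_equiv _ e
  -- the characters `γ ↦ v_p(N(det γ)) mod 3`, `p` prime
  let ψ : Nat.Primes → (Kˣ →* Multiplicative ℤ) := fun p =>
    haveI : Fact p.1.Prime := ⟨p.2⟩
    MonoidHom.mk' (fun x => Multiplicative.ofAdd (padicValRat p.1 (Algebra.norm ℚ (x : K))))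
      fun x y => by
        have hx : Algebra.norm ℚ (x : K) ≠ 0 := (x.map (Algebra.norm ℚ : K →* ℚ)).ne_zero
        have hy : Algebra.norm ℚ (y : K) ≠ 0 := (y.map (Algebra.norm ℚ : K →* ℚ)).ne_zero
        rw [← ofAdd_add, Units.val_mul, map_mul, padicValRat.mul hx hy]
  let Φ : Nat.Primes → (Additive Γ →+ ZMod 3) := fun p =>
    (Int.castAddHom (ZMod 3)).comp (MonoidHom.toAdditiveLeft
      ((ψ p).comp (Matrix.GeneralLinearGroup.det.comp Γ.subtype)))
  -- the test elements `diag(ℓ, 1) ∈ Γ`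
  have hmem : ∀ γ : GL (Fin 2) K, γ ∈ Γ := fun γ => by
    rw [hΓ, Subgroup.mem_comap]; exact Subgroup.mem_top _
  let uℓ : Nat.Primes → Kˣ := fun ℓ => Units.mk0 (ℓ : K) (by exact_mod_cast ℓ.2.ne_zero)
  let γℓ : Nat.Primes → Γ := fun ℓ => ⟨glDiagonal 2 K ![uℓ ℓ, 1], hmem _⟩
  have hΦ : ∀ p ℓ : Nat.Primes, Φ p (Additive.ofMul (γℓ ℓ)) =
      ((2 * (padicValNat p.1 ℓ.1 : ℤ) : ℤ) : ZMod 3) := by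
    intro p ℓ
    haveI : Fact p.1.Prime := ⟨p.2⟩
    simp only [Φ, ψ, γℓ, AddMonoidHom.coe_comp, Function.comp_apply, MonoidHom.coe_toAdditiveLeft,
      toMul_ofMul, MonoidHom.coe_comp, Subgroup.coe_subtype, det_glDiagonal_two_one,
      MonoidHom.mk'_apply, toAdd_ofAdd, Int.coe_castAddHom]
    congr 1
    have hu : ((uℓ ℓ : Kˣ) : K) = algebraMap ℚ K (ℓ.1 : ℚ) := by simp [uℓ]
    rw [hu, Algebra.norm_algebraMap, h2, padicValRat.pow, padicValRat.of_nat]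
    push_cast
    ring
  have hinj : Function.Injective Φ := by
    intro p p' hpp'
    by_contra hne
    haveI : Fact p.1.Prime := ⟨p.2⟩
    haveI : Fact p'.1.Prime := ⟨p'.2⟩
    have h := congrArg (fun φ => φ (Additive.ofMul (γℓ p))) hpp'
    simp only [hΦ] at h
    rw [padicValNat_self, padicValNat_primes (fun h' => hne (Subtype.ext h').symm)] at h
    revert h
    decide
  exact (Infinite.of_injective Φ hinj).not_finite ‹_›

/-! ### Load-bearing: compactness of the level -/

/-- **Any proof of `BianchiCongruenceCohomologyFinite` must use `IsCompact U`.** With the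
compactness of the level dropped (openness, finiteness of the coefficients and the field
hypotheses kept) the statement is FALSE: at `K = ℚ(ζ₃)` (imaginary quadratic:
`finrank_cyclotomicField_three`, `isTotallyComplex_cyclotomicField_three`), `U = ⊤` (open, not
compact), `Γ_U = GL₂(K)`, `A = ℤ/3` with trivial action and `q = 1`, `H¹(GL₂(K), ℤ/3)` is infinite
(`not_finite_H1_trivial_zmod_three`).  The compactness is what makes `Γ_U` arithmetic
(commensurable with `GL₂(𝓞_K)`, `BigHeckeGLn.commensurable_comap_globalEmbedding_glIntegers`),
hence finitely generated / of type (WFL); `GL₂(K)` is not even finitely generated. [folklore] -/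
theorem bianchiCongruenceCohomologyFinite_false_without_isCompact :
    ¬ ∀ (K : Type) [Field K] [NumberField K], Module.finrank ℚ K = 2 → IsTotallyComplex K →
        ∀ (U : Subgroup (BigHeckeGLn.FiniteAdelicGL 2 K)),
          IsOpen (U : Set (BigHeckeGLn.FiniteAdelicGL 2 K)) →
          ∀ (A : Rep ℤ (U.comap (BigHeckeGLn.globalEmbedding 2 K))), Finite A →
            ∀ q : ℕ, Finite (groupCohomology A q) := fun h =>
  not_finite_H1_trivial_zmod_three (CyclotomicField 3 ℚ) finrank_cyclotomicField_three
    (h (CyclotomicField 3 ℚ) finrank_cyclotomicField_three isTotallyComplex_cyclotomicField_three ⊤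
      isOpen_univ (Rep.trivial ℤ _ (ZMod 3)) (inferInstanceAs (Finite (ZMod 3))) 1)

end Summit.Langlands.Langlands.Theorems.BianchiCongruenceCohomologyFinite.Negative

end
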